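import Summits.AtomisticToContinuum.Crystallization.Theses.GappedShellCensus
import Literature.Geometry.DiscreteGeometry.SphericalCodeHullEulerFormula

/-!
# Bonds are hull edges

Worker lemma `stub_bondHullEdge` of the crux `GappedShellCensus.ShellTrichotomy`
(line `Sketch`, census half).

A pure hull lemma on a finite set `X` of unit vectors of `ℝ³`: if `u ≠ v` are points of `X` with
`-1 < ⟪u, v⟫` and every other point `y ∈ X` satisfies `⟪u, y⟫ + ⟪v, y⟫ < 1 + ⟪u, v⟫`, then
`{u, v} ∈ hullEdges X`, i.e. `{u, v}` spans an exposed edge of `conv X`.  The exposing functional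
is `c₀ := (1 + ⟪u, v⟫)⁻¹ • (u + v)`: one has `⟪c₀, u⟫ = ⟪c₀, v⟫ = 1` and `⟪c₀, y⟫ < 1` for every
other `y ∈ X`, so the tight set of `c₀` is exactly `{u, v}`.  (Adapted line by line from the
tree's `Literature.Geometry.DiscreteGeometry.pair_mem_hullEdges_of_contact`, whose strict
inequality came from a uniform bound `⟪·, ·⟫ ≤ κ = ⟪u, v⟫` instead of the hypothesis `h`.)
For a gapped shell's bonds the hypothesis holds with margin (`2 · 0.5385 < 1 + 0.4583`).
-/

noncomputable section

namespace Summit.AtomisticToContinuum.Crystallization.Theorems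

open scoped RealInnerProductSpace
open Literature.Geometry.DiscreteGeometry

/-- **Bonds are hull edges** (pure hull lemma on unit vectors): if `⟪u,y⟫ + ⟪v,y⟫ < 1 + ⟪u,v⟫`
for every other point `y` of `X`, the functional `(1 + ⟪u,v⟫)⁻¹ (u + v)` exposes exactly
`{u, v}`.  For a gapped shell the hypothesis holds with margin (`2 · 0.5385 < 1 + 0.4583`). -/
theorem stub_bondHullEdge (X : Finset (EuclideanSpace ℝ (Fin 3))) (hX1 : ∀ y ∈ X, ‖y‖ = 1)
    (u v : EuclideanSpace ℝ (Fin 3)) (hu : u ∈ X) (hv : v ∈ X) (hne : u ≠ v) (huv : -1 < ⟪u, v⟫)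
    (h : ∀ y ∈ X, y ≠ u → y ≠ v → ⟪u, y⟫ + ⟪v, y⟫ < 1 + ⟪u, v⟫) :
    ({u, v} : Finset (EuclideanSpace ℝ (Fin 3))) ∈ hullEdges X := by
  classical
  -- adapted from `Literature.Geometry.DiscreteGeometry.pair_mem_hullEdges_of_contact`
  set κ : ℝ := ⟪u, v⟫ with hκ
  have h1κ : 0 < 1 + κ := by linarith
  have huu : ⟪u, u⟫ = 1 := by rw [real_inner_self_eq_norm_sq, hX1 u hu]; norm_num
  have hvv : ⟪v, v⟫ = 1 := by rw [real_inner_self_eq_norm_sq, hX1 v hv]; norm_num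
  have hvu : ⟪v, u⟫ = κ := by rw [real_inner_comm]
  set c₀ : EuclideanSpace ℝ (Fin 3) := (1 + κ)⁻¹ • (u + v) with hc₀
  have hc₀y : ∀ y, ⟪c₀, y⟫ = (1 + κ)⁻¹ * (⟪u, y⟫ + ⟪v, y⟫) := fun y => by
    rw [hc₀, real_inner_smul_left, inner_add_left]
  have hc₀u : ⟪c₀, u⟫ = 1 := by
    rw [hc₀y, huu, hvu, inv_mul_cancel₀ h1κ.ne']
  have hc₀v : ⟪c₀, v⟫ = 1 := by
    rw [hc₀y, hvv, ← hκ, add_comm κ 1, inv_mul_cancel₀ h1κ.ne']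
  have hlt : ∀ y ∈ X, y ≠ u → y ≠ v → ⟪c₀, y⟫ < 1 := by
    intro y hy hyu hyv
    rw [hc₀y, inv_mul_lt_iff₀ h1κ, mul_one]
    exact h y hy hyu hyv
  have hle : ∀ y ∈ X, ⟪c₀, y⟫ ≤ 1 := by
    intro y hy
    by_cases hyu : y = u
    · rw [hyu, hc₀u]
    by_cases hyv : y = v
    · rw [hyv, hc₀v]
    exact (hlt y hy hyu hyv).le
  have htight : tightSet X c₀ = {u, v} := by
    ext y
    rw [mem_tightSet, Finset.mem_insert, Finset.mem_singleton]
    constructor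
    · rintro ⟨hy, hy1⟩
      by_contra h'
      push Not at h'
      exact (hlt y hy h'.1 h'.2).ne hy1
    · rintro (rfl | rfl)
      · exact ⟨hu, hc₀u⟩
      · exact ⟨hv, hc₀v⟩
  refine mem_hullEdges.2 ⟨c₀, ⟨hle, ?_⟩, htight⟩
  rw [htight, Finset.card_pair hne]

end Summit.AtomisticToContinuum.Crystallization.Theorems
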